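import Mathlib
import Literature.Probability.Percolation.PercolationProofs
import Literature.Probability.Percolation.TwoClusterConditionalAssociation
import Summits.CriticalPhenomena.PercolationContinuityZ3.Theorems.PercNearOneGluingNearOneGluingKnLemma3i

/-!
# Crux `PercNearOneGluing.NoHeavyLowerTail` (stmt-CriticalPhenomena-4575), line
`bhk-superadditivity-thinning` — stub `pureExchange` (the pure exchange inequality `PX`)

Helper file for the crux skeleton (lead prover-line-stmt-CriticalPhenomena-4575-c4-0): proves
exactly the registered stub signature `pureExchange`; lands with
`--supports stmt-CriticalPhenomena-4575`.

## Content

Weighted complete graph on `Fin n`, law `μ = prodBernoulli w` on `BondConfig (Fin n)`; write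
`x ↔ y` for `ω ∈ openConn x y`.  For vertices `m, h, b, z` with `μ(m ↔ b) ≤ μ(h ↔ b)`
("`m` is at most as connected to `b` as `h` is"):

`μ{m ↔ b, z ↮ b, h ↔ z} ≤ μ{z ↔ b, m ↮ b, m ↮ h}`.

This is the exchange inequality behind the `r`-order (MAXD) step of the first-pioneer charging
induction; it holds on arbitrary finite weighted graphs.

## Proof

Put `Q = {h ↔ z}`.
* `Q` is increasing and determined by the open edge cluster `C_h` of `h` in the sense of
  Kozma–Nitzan Lemma 3(i) (`pureExchange_Q_mono`): an open path from `h` to `z ≠ h` ends with an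
  edge of `C_h` (`reachable_iff_exists_mem_openEdgeCluster`), so `C_h(ω) ⊆ C_h(ω')` and `ω ∈ Q`
  force `ω' ∈ Q`.
* KN Lemma 3(i) (`knLemma3i`, in the tree) with `a₁ = m`, `a₂ = h`, `d = 0`:
  `μ({m ↔ b} ∩ Q) ≤ μ({h ↔ b} ∩ Q)`.
* Splitting both sides along `{h ↔ b}` resp. `{m ↔ b}` (`measureReal_inter_add_sdiff`), the common
  part `{m ↔ b} ∩ Q ∩ {h ↔ b}` cancels:
  `μ(({m ↔ b} ∩ Q) \ {h ↔ b}) ≤ μ(({h ↔ b} ∩ Q) \ {m ↔ b})`.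
* The left event of `PX` lies in `({m ↔ b} ∩ Q) \ {h ↔ b}` (`h ↔ b` and `h ↔ z` would give
  `z ↔ b`), and `({h ↔ b} ∩ Q) \ {m ↔ b}` lies in the right event (`h ↔ z`, `h ↔ b` give `z ↔ b`;
  `m ↔ h` and `h ↔ b` would give `m ↔ b`).  Conclude by monotonicity (`measureReal_mono`).
-/

namespace Summit.CriticalPhenomena.PercolationContinuityZ3.Theorems

open MeasureTheory Set
open Literature.Probability.LatticeModels (prodBernoulli)
open Literature.Probability.Percolation (BondConfig openConn openGraph openEdgeCluster
  reachable_iff_exists_mem_openEdgeCluster)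

noncomputable section
open Classical

section PureExchangeAux

variable {n : ℕ}

/-- The event `Q = {h ↔ z}` is increasing and determined by the open edge cluster of `h` in the
sense of Kozma–Nitzan Lemma 3(i) (hypothesis shape of `knLemma3i`): if `ω ∈ Q` and
`C_h(ω) ⊆ C_h(ω')` then `ω' ∈ Q` (an open path from `h` to `z ≠ h` ends with an edge of `C_h`).
[folklore] -/
theorem pureExchange_Q_mono (h z : Fin n) :
    ∀ ω ω' : BondConfig (Fin n), ω ∈ (openConn h z : Set (BondConfig (Fin n))) →
      openEdgeCluster ω h ⊆ openEdgeCluster ω' h →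
      ω' ∈ (openConn h z : Set (BondConfig (Fin n))) := by
  intro ω ω' hω hsub
  rcases (reachable_iff_exists_mem_openEdgeCluster ω h z).1 hω with rfl | ⟨e, he, hze⟩
  · exact SimpleGraph.Reachable.refl _
  · exact (reachable_iff_exists_mem_openEdgeCluster ω' h z).2 (Or.inr ⟨e, hsub he, hze⟩)

/-- The left event of `PX` lies in `({m ↔ b} ∩ {h ↔ z}) \ {h ↔ b}`: on it `m ↔ b` and `h ↔ z`,
and `h ↔ b` together with `h ↔ z` would give `z ↔ b`. [folklore] -/
theorem pureExchange_left_subset (m h b z : Fin n) :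
    (openConn m b ∩ (openConn z b)ᶜ ∩ openConn h z : Set (BondConfig (Fin n))) ⊆
      (openConn m b ∩ openConn h z) \ openConn h b := by
  rintro ω ⟨⟨hmb, hzb⟩, hhz⟩
  refine ⟨⟨hmb, hhz⟩, fun hhb => hzb ?_⟩
  exact SimpleGraph.Reachable.trans (SimpleGraph.Reachable.symm hhz) hhb

/-- `({h ↔ b} ∩ {h ↔ z}) \ {m ↔ b}` lies in the right event of `PX`: `h ↔ z` and `h ↔ b` give
`z ↔ b`, `m ↮ b` is given, and `m ↔ h` together with `h ↔ b` would give `m ↔ b`. [folklore] -/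
theorem pureExchange_right_subset (m h b z : Fin n) :
    ((openConn h b ∩ openConn h z) \ openConn m b : Set (BondConfig (Fin n))) ⊆
      openConn z b ∩ (openConn m b)ᶜ ∩ (openConn m h)ᶜ := by
  rintro ω ⟨⟨hhb, hhz⟩, hmb⟩
  refine ⟨⟨?_, hmb⟩, fun hmh => hmb ?_⟩
  · exact SimpleGraph.Reachable.trans (SimpleGraph.Reachable.symm hhz) hhb
  · exact SimpleGraph.Reachable.trans hmh hhb

end PureExchangeAux

/-- **The pure exchange inequality `PX`** (registered stub `pureExchange` of crux
stmt-CriticalPhenomena-4575, line bhk-superadditivity-thinning).  On the weighted complete graph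
`Fin n` with law `μ = prodBernoulli w`: if `μ(m ↔ b) ≤ μ(h ↔ b)`, then
`μ{m ↔ b, z ↮ b, h ↔ z} ≤ μ{z ↔ b, m ↮ b, m ↮ h}`.
From Kozma–Nitzan Lemma 3(i) (`knLemma3i`, `d = 0`, `Q = {h ↔ z}`).
[cite: KozmaNitzan2024, Lemma 3(i)] -/
theorem pureExchange : ∀ (n : ℕ) (w : Sym2 (Fin n) → unitInterval) (m h b z : Fin n), (Literature.Probability.LatticeModels.prodBernoulli w).real (Literature.Probability.Percolation.openConn m b) ≤ (Literature.Probability.LatticeModels.prodBernoulli w).real (Literature.Probability.Percolation.openConn h b) → (Literature.Probability.LatticeModels.prodBernoulli w).real (Literature.Probability.Percolation.openConn m b ∩ (Literature.Probability.Percolation.openConn z b)ᶜ ∩ Literature.Probability.Percolation.openConn h z) ≤ (Literature.Probability.LatticeModels.prodBernoulli w).real (Literature.Probability.Percolation.openConn z b ∩ (Literature.Probability.Percolation.openConn m b)ᶜ ∩ (Literature.Probability.Percolation.openConn m h)ᶜ) := by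
  intro n w m h b z hle
  -- KN Lemma 3(i) with `a₁ = m`, `a₂ = h`, `d = 0`, `Q = {h ↔ z}`
  have hkn := knLemma3i n w m h b (openConn h z) 0 (pureExchange_Q_mono h z) le_rfl
    (by rw [add_zero]; exact hle)
  rw [zero_mul, add_zero] at hkn
  -- split both sides along `{h ↔ b}` resp. `{m ↔ b}`; the common part cancels
  have hmb : MeasurableSet (openConn m b : Set (BondConfig (Fin n))) := MeasurableSet.of_discrete
  have hhb : MeasurableSet (openConn h b : Set (BondConfig (Fin n))) := MeasurableSet.of_discrete
  have hs1 := measureReal_inter_add_sdiff (μ := prodBernoulli w)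
    (s := (openConn m b ∩ openConn h z : Set (BondConfig (Fin n)))) hhb
  have hs2 := measureReal_inter_add_sdiff (μ := prodBernoulli w)
    (s := (openConn h b ∩ openConn h z : Set (BondConfig (Fin n)))) hmb
  have hcommon : (openConn m b ∩ openConn h z ∩ openConn h b : Set (BondConfig (Fin n))) =
      openConn h b ∩ openConn h z ∩ openConn m b := by
    ext ω
    simp only [Set.mem_inter_iff]
    tauto
  rw [hcommon] at hs1
  have hdiff : (prodBernoulli w).real ((openConn m b ∩ openConn h z) \ openConn h b) ≤
      (prodBernoulli w).real ((openConn h b ∩ openConn h z) \ openConn m b) := by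
    linarith
  -- monotonicity on both sides
  calc (prodBernoulli w).real (openConn m b ∩ (openConn z b)ᶜ ∩ openConn h z)
      ≤ (prodBernoulli w).real ((openConn m b ∩ openConn h z) \ openConn h b) :=
        measureReal_mono (pureExchange_left_subset m h b z)
    _ ≤ (prodBernoulli w).real ((openConn h b ∩ openConn h z) \ openConn m b) := hdiff
    _ ≤ (prodBernoulli w).real (openConn z b ∩ (openConn m b)ᶜ ∩ (openConn m h)ᶜ) :=
        measureReal_mono (pureExchange_right_subset m h b z)

end

end Summit.CriticalPhenomena.PercolationContinuityZ3.Theorems
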